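import Summits.HubbardSuperconductivity.HubbardSuperconductivity.Theses.AposterioriCapRg
import Literature.MathematicalPhysics.QuantumLattice.DWaveOrderParameterProofs

/-!
# drefute (line `cauchy-griffiths-source-shells`): clause (a) of the lead's `stub_sourceAnalyticShells`
# ALREADY implies the crux — the stairs (clause (b), `stub_shellCurvatureBudget`, `stub_slopeTransfer`)
# are logically redundant as typed.

The lead's stub P (`Lines/cauchy-griffiths-source-shells.lean`, registered 04:33Z) concludes, under EXACTLY
R's hypotheses plus `0 < fst`, the conjunction of
(a) `(3/4)·fst ≤ liminf_L dWaveSourceDensity (L+1) U μ h₀` — at R's OWN `h₀` — and (b) the shell budgets.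
R's hypothesis is DOWNWARD CLOSED in `h₀` (certification on `Ioc 0 h₀` restricts to `Ioc 0 h` for `h ≤ h₀`),
so (a) at the given `h₀` for all instances gives (a) at every `h ∈ (0, h₀]`, hence
`(3/4)·fst ≤ dWaveOrderParameter U μ` (`le_dWaveOrderParameter_of_forall`), which is R with constant `3/4`.
Kernel-checked below: `R_of_topStairFloor`, `R_of_stubP` (sorry-free; no use of (b), M2, M3).
Reading: (a) as typed is the crux restated pointwise in `h` with the stronger constant `3/4` (Disproof §2b's
"honesty with c ≤ 2" at `c = 4/3`); the line intended (a) at a TOP STAIR `h₁` of its own choosing where the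
phase mode is massive — see stubs/StubSourceAnalyticShells.md for the corrected shape and why R's `∀ h₀`
then forces either an extra hypothesis `h_mass(D) ≤ h₀` or a small-field floor (= the crux).
-/

open Filter Set
open Literature.MathematicalPhysics.QuantumLattice
open Summit.HubbardSuperconductivity.HubbardSuperconductivity.Theses.AposterioriCapRg

namespace DrefutePartA

/-- Clause (a) of the lead's `stub_sourceAnalyticShells`, verbatim (thresholds ∃-bound as there), WITHOUT (b). -/
def TopStairFloor : Prop :=
  ∃ kStar etaStar : ℚ, 0 < kStar ∧ 0 < etaStar ∧
    ∀ (U μ h₀ : ℝ) (D : HubbardScaleData), 0 < h₀ →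
    (∀ h ∈ Set.Ioc (0:ℝ) h₀, ∃ L₀ : ℕ, D.IsCertifiedEnclosure (hubbardScaleReportCT U μ D h) L₀) →
    D.MeetsThresholds kStar etaStar → 0 < D.meanFieldDensity.fst →
    (3 / 4 : ℝ) * ((D.meanFieldDensity.fst : ℚ) : ℝ) ≤ liminf (fun L : ℕ => dWaveSourceDensity (L + 1) U μ h₀) atTop

/-- The lead's `stub_sourceAnalyticShells`, verbatim (statement only). -/
def StubP : Prop :=
  ∃ kStar etaStar : ℚ, 0 < kStar ∧ 0 < etaStar ∧
    ∀ (U μ h₀ : ℝ) (D : HubbardScaleData), 0 < h₀ →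
    (∀ h ∈ Set.Ioc (0:ℝ) h₀, ∃ L₀ : ℕ, D.IsCertifiedEnclosure (hubbardScaleReportCT U μ D h) L₀) →
    D.MeetsThresholds kStar etaStar → 0 < D.meanFieldDensity.fst →
    (3 / 4 : ℝ) * ((D.meanFieldDensity.fst : ℚ) : ℝ) ≤ liminf (fun L : ℕ => dWaveSourceDensity (L + 1) U μ h₀) atTop ∧
    ∃ Φ : ℝ → ℝ, (∀ J : ℕ, ∑ j ∈ Finset.range (J + 1), Φ (h₀ / 2 ^ j) ≤ ((D.meanFieldDensity.fst : ℚ) : ℝ) / 4) ∧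
      ∀ h ∈ Set.Ioc (0:ℝ) h₀, ∀ᶠ L : ℕ in atTop,
        ∃ (a b : ℝ) (n : ℕ) (g : Fin n → ℂ → ℂ) (r s : Fin n → ℝ),
          (∀ i, 0 < r i) ∧
          (∀ i, ∀ t ∈ Set.Icc (h / 2) (2 * h), DifferentiableOn ℂ (g i) (Metric.ball (t : ℂ) (r i)) ∧
            ∀ z ∈ Metric.ball (t : ℂ) (r i), ‖g i z - g i t‖ ≤ s i) ∧
          (∀ t ∈ Set.Icc (h / 2) (2 * h),
            (dWaveSourceTorus (L + 1) U μ t).groundEnergy = a + b * t + ∑ i, (g i t).re) ∧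
          6 * h * ∑ i, s i / r i ^ 2 ≤ 2 * Φ h * ((L + 1 : ℕ) : ℝ) ^ 2

/-- Projection: stub P ⇒ its clause (a). -/
theorem topStairFloor_of_stubP (hP : StubP) : TopStairFloor := by
  obtain ⟨kStar, etaStar, hk, he, H⟩ := hP
  exact ⟨kStar, etaStar, hk, he, fun U μ h₀ D hh₀ hcert hthr hpos => (H U μ h₀ D hh₀ hcert hthr hpos).1⟩

/-- **Clause (a) alone proves the crux, with constant `3/4`** (downward closure of R's hypothesis in `h₀`). -/
theorem threeQuarters_of_topStairFloor (hA : TopStairFloor) :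
    ∃ kStar etaStar : ℚ, 0 < kStar ∧ 0 < etaStar ∧
      ∀ (U μ h₀ : ℝ) (D : HubbardScaleData), 0 < h₀ →
      (∀ h ∈ Set.Ioc (0:ℝ) h₀, ∃ L₀ : ℕ, D.IsCertifiedEnclosure (hubbardScaleReportCT U μ D h) L₀) →
      D.MeetsThresholds kStar etaStar → 0 < D.meanFieldDensity.fst →
      (3 / 4 : ℝ) * ((D.meanFieldDensity.fst : ℚ) : ℝ) ≤ dWaveOrderParameter U μ := by
  obtain ⟨kStar, etaStar, hk, he, H⟩ := hA
  refine ⟨kStar, etaStar, hk, he, fun U μ h₀ D hh₀ hcert hthr hpos => ?_⟩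
  refine le_dWaveOrderParameter_of_forall U μ hh₀ fun h hh => ?_
  exact H U μ h D hh.1 (fun h' hh' => hcert h' ⟨hh'.1, hh'.2.trans hh.2.le⟩) hthr hpos

/-- **R from clause (a) alone.** -/
theorem R_of_topStairFloor (hA : TopStairFloor) : AposterioriOrderCriterionR := by
  obtain ⟨kStar, etaStar, hk, he, H⟩ := threeQuarters_of_topStairFloor hA
  refine ⟨kStar, etaStar, hk, he, fun U μ h₀ D hh₀ hcert hthr => ?_⟩
  by_cases hpos : 0 < D.meanFieldDensity.fst
  · have h34 := H U μ h₀ D hh₀ hcert hthr hpos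
    have hcast : (0 : ℝ) < ((D.meanFieldDensity.fst : ℚ) : ℝ) := by exact_mod_cast hpos
    linarith
  · have hD : ((D.meanFieldDensity.fst : ℚ) : ℝ) ≤ 0 := by exact_mod_cast (not_lt.1 hpos)
    linarith [dWaveOrderParameter_nonneg U μ]

/-- **R from the lead's stub P without the two mathematical stubs**: (b), `stub_shellCurvatureBudget` and
`stub_slopeTransfer` are not needed by the composition as typed. -/
theorem R_of_stubP (hP : StubP) : AposterioriOrderCriterionR :=
  R_of_topStairFloor (topStairFloor_of_stubP hP)

end DrefutePartA

/-! ## Reshape 1 of the lead (Lines/cauchy_griffiths_source_shells.lean, 04:44Z): `∃ h₁ ∈ Ioc 0 h₀` — clause (a) STILL gives R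

Monotonicity of the stairs (`liminf_dWaveSourceDensity_mono`) moves a floor at ANY `h₁ ≤ h₀` up to `h₀`; downward closure
then gives R.  So every stub of the shape "under R's hypotheses, a floor `c·fst` at SOME stair `h₁ ∈ (0, h₀]`" implies R with
constant `c`, wherever the stair sits: the stairs/curvature machinery below `h₁` is logically idle unless clause (a) is stated
under a hypothesis that is NOT downward closed in `h₀` (e.g. `h_mass(D) ≤ h₁`, vacuous for small `h₀` — and then R itself needs
`h_mass(D) ≤ h₀`). -/

namespace DrefutePartA

/-- "A floor `(3/4)·fst` at SOME stair `h₁ ∈ (0,h₀]`", under R's hypotheses — clause (a) of the lead's reshape 1. -/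
def ExistsStairFloor : Prop :=
  ∃ kStar etaStar : ℚ, 0 < kStar ∧ 0 < etaStar ∧
    ∀ (U μ h₀ : ℝ) (D : HubbardScaleData), 0 < h₀ →
    (∀ h ∈ Set.Ioc (0:ℝ) h₀, ∃ L₀ : ℕ, D.IsCertifiedEnclosure (hubbardScaleReportCT U μ D h) L₀) →
    D.MeetsThresholds kStar etaStar → 0 < D.meanFieldDensity.fst →
    ∃ h₁ ∈ Set.Ioc (0:ℝ) h₀,
      (3 / 4 : ℝ) * ((D.meanFieldDensity.fst : ℚ) : ℝ) ≤ liminf (fun L : ℕ => dWaveSourceDensity (L + 1) U μ h₁) atTop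

/-- The lead's RESHAPED `stub_sourceAnalyticShells` (reshape 1, 04:44Z), verbatim (statement only). -/
def StubP1 : Prop :=
  ∃ kStar etaStar : ℚ, 0 < kStar ∧ 0 < etaStar ∧
    ∀ (U μ h₀ : ℝ) (D : HubbardScaleData), 0 < h₀ →
    (∀ h ∈ Set.Ioc (0:ℝ) h₀, ∃ L₀ : ℕ, D.IsCertifiedEnclosure (hubbardScaleReportCT U μ D h) L₀) →
    D.MeetsThresholds kStar etaStar → 0 < D.meanFieldDensity.fst →
    ∃ h₁ ∈ Set.Ioc (0:ℝ) h₀,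
    (3 / 4 : ℝ) * ((D.meanFieldDensity.fst : ℚ) : ℝ) ≤ liminf (fun L : ℕ => dWaveSourceDensity (L + 1) U μ h₁) atTop ∧
    ∃ Φ : ℝ → ℝ, (∀ J : ℕ, ∑ j ∈ Finset.range (J + 1), Φ (h₁ / 2 ^ j) ≤ ((D.meanFieldDensity.fst : ℚ) : ℝ) / 4) ∧
      ∀ h ∈ Set.Ioc (0:ℝ) h₁, ∀ᶠ L : ℕ in atTop,
        ∃ (a b : ℝ) (n : ℕ) (g : Fin n → ℂ → ℂ) (r s : Fin n → ℝ),
          (∀ i, 0 < r i) ∧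
          (∀ i, ∀ t ∈ Set.Icc (h / 2) (2 * h), DifferentiableOn ℂ (g i) (Metric.ball (t : ℂ) (r i)) ∧
            ∀ z ∈ Metric.ball (t : ℂ) (r i), ‖g i z - g i t‖ ≤ s i) ∧
          (∀ t ∈ Set.Icc (h / 2) (2 * h),
            (dWaveSourceTorus (L + 1) U μ t).groundEnergy = a + b * t + ∑ i, (g i t).re) ∧
          6 * h * ∑ i, s i / r i ^ 2 ≤ 2 * Φ h * ((L + 1 : ℕ) : ℝ) ^ 2

/-- Projection: reshaped stub P ⇒ a floor at some stair. -/
theorem existsStairFloor_of_stubP1 (hP : StubP1) : ExistsStairFloor := by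
  obtain ⟨kStar, etaStar, hk, he, H⟩ := hP
  refine ⟨kStar, etaStar, hk, he, fun U μ h₀ D hh₀ hcert hthr hpos => ?_⟩
  obtain ⟨h₁, hh₁, hfloor, -⟩ := H U μ h₀ D hh₀ hcert hthr hpos
  exact ⟨h₁, hh₁, hfloor⟩

/-- **Monotone stairs**: a floor at some `h₁ ≤ h₀` is a floor at `h₀`. -/
theorem topStairFloor_of_existsStairFloor (hE : ExistsStairFloor) : TopStairFloor := by
  obtain ⟨kStar, etaStar, hk, he, H⟩ := hE
  refine ⟨kStar, etaStar, hk, he, fun U μ h₀ D hh₀ hcert hthr hpos => ?_⟩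
  obtain ⟨h₁, hh₁, hfloor⟩ := H U μ h₀ D hh₀ hcert hthr hpos
  exact hfloor.trans (liminf_dWaveSourceDensity_mono U μ hh₁.1.le hh₁.2)

/-- **R from clause (a) of the RESHAPED stub alone** — the curvature ladder below `h₁`, `stub_shellCurvatureBudget` and
`stub_slopeTransfer` are still not needed. -/
theorem R_of_stubP1 (hP : StubP1) : AposterioriOrderCriterionR :=
  R_of_topStairFloor (topStairFloor_of_existsStairFloor (existsStairFloor_of_stubP1 hP))

end DrefutePartA

/-! ## Clause (a) IS the crux with constant `3/4`, up to logical equivalence -/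

namespace DrefutePartA

/-- R with constant `c` in place of `1/2` (restricted to positive floors, which is all that matters). -/
def RWithConstant (c : ℝ) : Prop :=
  ∃ kStar etaStar : ℚ, 0 < kStar ∧ 0 < etaStar ∧
    ∀ (U μ h₀ : ℝ) (D : HubbardScaleData), 0 < h₀ →
    (∀ h ∈ Set.Ioc (0:ℝ) h₀, ∃ L₀ : ℕ, D.IsCertifiedEnclosure (hubbardScaleReportCT U μ D h) L₀) →
    D.MeetsThresholds kStar etaStar → 0 < D.meanFieldDensity.fst →
    c * ((D.meanFieldDensity.fst : ℚ) : ℝ) ≤ dWaveOrderParameter U μ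

/-- **Clause (a) of stub P (either shape) ⟺ R with constant `3/4`**: the "one massive computation at the top stair" is,
as a statement, exactly the crux with a stronger constant. -/
theorem topStairFloor_iff_R34 : TopStairFloor ↔ RWithConstant (3 / 4) := by
  constructor
  · exact threeQuarters_of_topStairFloor
  · rintro ⟨kStar, etaStar, hk, he, H⟩
    refine ⟨kStar, etaStar, hk, he, fun U μ h₀ D hh₀ hcert hthr hpos => ?_⟩
    exact (H U μ h₀ D hh₀ hcert hthr hpos).trans (dWaveOrderParameter_le_liminf U μ hh₀)

theorem existsStairFloor_iff_R34 : ExistsStairFloor ↔ RWithConstant (3 / 4) := by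
  constructor
  · exact fun h => topStairFloor_iff_R34.1 (topStairFloor_of_existsStairFloor h)
  · rintro hR
    obtain ⟨kStar, etaStar, hk, he, H⟩ := topStairFloor_iff_R34.2 hR
    exact ⟨kStar, etaStar, hk, he, fun U μ h₀ D hh₀ hcert hthr hpos =>
      ⟨h₀, ⟨hh₀, le_rfl⟩, H U μ h₀ D hh₀ hcert hthr hpos⟩⟩

end DrefutePartA
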